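import Literature.NumberTheory.Sieve.CFSemigroupCongruence
import HarnessLib

/-!
# `SL₂(ℤ/qℤ)` is perfect for `(q, 6) = 1`, and generating sets of perfect groups are aperiodic

Support file (all results proved) for the named fact
`Literature.NumberTheory.Sieve.MageeOhWinter2019_uniformCounting` (`CFSemigroupCounting.lean`).
The modulus `Q₀` in [MageeOhWinter2019, Thm. 1] excludes finitely many primes at which the
congruence count of `Γ_A` is genuinely biased: the leading eigenvalue `1` of the congruence
transfer operator `L_{δ,q}` ([MageeOhWinter2019, §3.2, eq. (3.4)]) must be simple with constant
eigenvector over `Γ_q = SL₂(ℤ/qℤ)`, and `L_{δ,q}` must have no other unimodular eigenvalues — i.e.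
the image of `Γ_A` must generate `Γ_q` (proved in `CFSemigroupCongruence.lean` for `(q, b-a) = 1`)
APERIODICALLY. This file supplies the group-theoretic input:

* `sl2_commutator_eq_top`: **`SL₂(ℤ/qℤ)` is perfect for `(q, 6) = 1`** (every unipotent is the
  commutator `[diag(2, 2⁻¹), (1 x/3; 0 1)]`, and unipotents generate: `⟨S, T⟩ = SL₂(ℤ) ↠ SL₂(ℤ/q)`);
  `monoidHom_eq_one_of_comm`: every homomorphism from `SL₂(ℤ/qℤ)` to a commutative group is trivial;
* `eq_one_of_graded_function`: **aperiodicity of generating sets of perfect finite groups**: if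
  `S` generates `G`, every homomorphism `G → ℂˣ` is trivial, and a nowhere-zero `f : G → ℂ`
  satisfies `f(ξ s) = μ f(ξ)` for all `ξ` and all `s ∈ S`, then `μ = 1` (`ξ ↦ f(ξ)/f(1)` is a
  character). [cite: MageeOhWinter2019, Thm. 1]

## References

* M. Magee, H. Oh, D. Winter, J. reine angew. Math. 753 (2019) 89–135, Thm. 1, §3.2. [MageeOhWinter2019]
* G. Shimura, Introduction to the arithmetic theory of automorphic functions (1971), Lemma 1.38.
  [ShimuraIATAF1971]
-/

noncomputable section

open scoped MatrixGroups commutatorElement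

namespace Literature.NumberTheory.Sieve

/-! ### Unipotents are commutators when `2` and `3` are invertible -/

/-- `(1 x; 0 1)(1 y; 0 1) = (1 x+y; 0 1)`. [folklore] -/
theorem cfUpper_mul {q : ℕ} (x y : ZMod q) : cfUpper x * cfUpper y = cfUpper (x + y) :=
  (cfUpperHom q).map_mul (Multiplicative.ofAdd x) (Multiplicative.ofAdd y) |>.symm

/-- `(1 0; x 1)(1 0; y 1) = (1 0; x+y 1)`. [folklore] -/
theorem cfLower_mul {q : ℕ} (x y : ZMod q) : cfLower x * cfLower y = cfLower (x + y) :=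
  (cfLowerHom q).map_mul (Multiplicative.ofAdd x) (Multiplicative.ofAdd y) |>.symm

/-- `(1 0; 0 1)`. [folklore] -/
theorem cfUpper_zero {q : ℕ} : cfUpper (0 : ZMod q) = 1 := (cfUpperHom q).map_one

/-- `(1 0; 0 1)`. [folklore] -/
theorem cfLower_zero {q : ℕ} : cfLower (0 : ZMod q) = 1 := (cfLowerHom q).map_one

/-- `(1 x; 0 1)⁻¹ = (1 -x; 0 1)`. [folklore] -/
theorem cfUpper_inv {q : ℕ} (x : ZMod q) : (cfUpper x)⁻¹ = cfUpper (-x) :=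
  inv_eq_of_mul_eq_one_right (by rw [cfUpper_mul, add_neg_cancel, cfUpper_zero])

/-- `(1 0; x 1)⁻¹ = (1 0; -x 1)`. [folklore] -/
theorem cfLower_inv {q : ℕ} (x : ZMod q) : (cfLower x)⁻¹ = cfLower (-x) :=
  inv_eq_of_mul_eq_one_right (by rw [cfLower_mul, add_neg_cancel, cfLower_zero])

/-- The diagonal element `diag(u, u⁻¹) ∈ SL₂(ℤ/qℤ)` for a unit `u`. [folklore] -/
def cfDiag {q : ℕ} (u : (ZMod q)ˣ) : SL(2, ZMod q) :=
  ⟨!![(u : ZMod q), 0; 0, ((u⁻¹ : (ZMod q)ˣ) : ZMod q)], by simp [Matrix.det_fin_two_of]⟩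

/-- `diag(u,u⁻¹)⁻¹ = diag(u⁻¹,u)`. [folklore] -/
theorem cfDiag_inv {q : ℕ} (u : (ZMod q)ˣ) : (cfDiag u)⁻¹ = cfDiag u⁻¹ := by
  refine inv_eq_of_mul_eq_one_right (Subtype.ext ?_)
  rw [Matrix.SpecialLinearGroup.coe_mul]
  show !![(u : ZMod q), 0; 0, ((u⁻¹ : (ZMod q)ˣ) : ZMod q)] *
      !![((u⁻¹ : (ZMod q)ˣ) : ZMod q), 0; 0, (((u⁻¹)⁻¹ : (ZMod q)ˣ) : ZMod q)] = 1
  rw [inv_inv]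
  ext i j
  fin_cases i <;> fin_cases j <;> simp [Matrix.mul_apply, Fin.sum_univ_two]

/-- **Conjugating a unipotent by the torus:** `diag(u,u⁻¹) (1 x; 0 1) diag(u,u⁻¹)⁻¹ = (1 u²x; 0 1)`. [folklore] -/
theorem cfDiag_conj_cfUpper {q : ℕ} (u : (ZMod q)ˣ) (x : ZMod q) :
    cfDiag u * cfUpper x * (cfDiag u)⁻¹ = cfUpper ((u : ZMod q) ^ 2 * x) := by
  have hu : (u : ZMod q) * ((u⁻¹ : (ZMod q)ˣ) : ZMod q) = 1 := by
    rw [← Units.val_mul, mul_inv_cancel, Units.val_one]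
  rw [cfDiag_inv]
  apply Subtype.ext
  rw [Matrix.SpecialLinearGroup.coe_mul, Matrix.SpecialLinearGroup.coe_mul]
  show !![(u : ZMod q), 0; 0, ((u⁻¹ : (ZMod q)ˣ) : ZMod q)] * !![1, x; 0, 1] *
      !![((u⁻¹ : (ZMod q)ˣ) : ZMod q), 0; 0, (((u⁻¹)⁻¹ : (ZMod q)ˣ) : ZMod q)] =
    !![1, (u : ZMod q) ^ 2 * x; 0, 1]
  rw [inv_inv]
  ext i j
  fin_cases i <;> fin_cases j <;> simp [Matrix.mul_apply, Fin.sum_univ_two, hu]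
  all_goals ring

/-- **Conjugating a lower unipotent by the torus:** `diag(u,u⁻¹)⁻¹ (1 0; x 1) diag(u,u⁻¹) = (1 0; u²x 1)`.
[folklore] -/
theorem cfDiag_inv_conj_cfLower {q : ℕ} (u : (ZMod q)ˣ) (x : ZMod q) :
    (cfDiag u)⁻¹ * cfLower x * cfDiag u = cfLower ((u : ZMod q) ^ 2 * x) := by
  have hu : (u : ZMod q) * ((u⁻¹ : (ZMod q)ˣ) : ZMod q) = 1 := by
    rw [← Units.val_mul, mul_inv_cancel, Units.val_one]
  rw [cfDiag_inv]
  apply Subtype.ext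
  rw [Matrix.SpecialLinearGroup.coe_mul, Matrix.SpecialLinearGroup.coe_mul]
  show !![((u⁻¹ : (ZMod q)ˣ) : ZMod q), 0; 0, (((u⁻¹)⁻¹ : (ZMod q)ˣ) : ZMod q)] * !![1, 0; x, 1] *
      !![(u : ZMod q), 0; 0, ((u⁻¹ : (ZMod q)ˣ) : ZMod q)] = !![1, 0; (u : ZMod q) ^ 2 * x, 1]
  rw [inv_inv]
  ext i j
  fin_cases i <;> fin_cases j <;> simp [Matrix.mul_apply, Fin.sum_univ_two, hu]
  all_goals ring

/-- **Upper unipotents are commutators:** `[diag(u,u⁻¹), (1 x; 0 1)] = (1 (u²-1)x; 0 1)`. [folklore] -/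
theorem commutatorElement_cfDiag_cfUpper {q : ℕ} (u : (ZMod q)ˣ) (x : ZMod q) :
    ⁅cfDiag u, cfUpper x⁆ = cfUpper (((u : ZMod q) ^ 2 - 1) * x) := by
  rw [commutatorElement_def, cfDiag_conj_cfUpper, cfUpper_inv, cfUpper_mul]
  congr 1
  ring

/-- **Lower unipotents are commutators:** `[diag(u,u⁻¹)⁻¹, (1 0; x 1)] = (1 0; (u²-1)x 1)`. [folklore] -/
theorem commutatorElement_cfDiag_inv_cfLower {q : ℕ} (u : (ZMod q)ˣ) (x : ZMod q) :
    ⁅(cfDiag u)⁻¹, cfLower x⁆ = cfLower (((u : ZMod q) ^ 2 - 1) * x) := by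
  rw [commutatorElement_def, inv_inv, cfDiag_inv_conj_cfLower, cfLower_inv, cfLower_mul]
  congr 1
  ring

/-! ### Perfectness -/

/-- `2` and `3` are units modulo `q` when `(q, 6) = 1`. [folklore] -/
theorem isUnit_two_three {q : ℕ} (hq : Nat.Coprime q 6) : IsUnit (2 : ZMod q) ∧ IsUnit (3 : ZMod q) := by
  have h2 : Nat.Coprime 2 q := (Nat.Coprime.coprime_dvd_right (by norm_num : 2 ∣ 6) hq).symm
  have h3 : Nat.Coprime 3 q := (Nat.Coprime.coprime_dvd_right (by norm_num : 3 ∣ 6) hq).symm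
  refine ⟨?_, ?_⟩
  · have h := (ZMod.unitOfCoprime 2 h2).isUnit
    rwa [ZMod.coe_unitOfCoprime, Nat.cast_ofNat] at h
  · have h := (ZMod.unitOfCoprime 3 h3).isUnit
    rwa [ZMod.coe_unitOfCoprime, Nat.cast_ofNat] at h

/-- Every upper unipotent is a commutator when `(q, 6) = 1`: `(1 y; 0 1) = [diag(2,2⁻¹), (1 y/3; 0 1)]`.
[folklore] -/
theorem cfUpper_mem_commutator {q : ℕ} (hq : Nat.Coprime q 6) (y : ZMod q) : cfUpper y ∈ commutator SL(2, ZMod q) := by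
  obtain ⟨h2, h3⟩ := isUnit_two_three hq
  obtain ⟨u, hu⟩ := h2
  obtain ⟨w, hw⟩ := h3
  have hkey : ((u : ZMod q) ^ 2 - 1) * (((w⁻¹ : (ZMod q)ˣ) : ZMod q) * y) = y := by
    have h1 : (u : ZMod q) ^ 2 - 1 = 3 := by rw [hu]; norm_num
    have h2' : (3 : ZMod q) * ((w⁻¹ : (ZMod q)ˣ) : ZMod q) = 1 := by
      rw [← hw, ← Units.val_mul, mul_inv_cancel, Units.val_one]
    rw [h1, ← mul_assoc, h2', one_mul]
  rw [← hkey, ← commutatorElement_cfDiag_cfUpper]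
  exact Subgroup.commutator_mem_commutator (Subgroup.mem_top (cfDiag u)) (Subgroup.mem_top (cfUpper _))

/-- Every lower unipotent is a commutator when `(q, 6) = 1`. [folklore] -/
theorem cfLower_mem_commutator {q : ℕ} (hq : Nat.Coprime q 6) (y : ZMod q) : cfLower y ∈ commutator SL(2, ZMod q) := by
  obtain ⟨h2, h3⟩ := isUnit_two_three hq
  obtain ⟨u, hu⟩ := h2
  obtain ⟨w, hw⟩ := h3
  have hkey : ((u : ZMod q) ^ 2 - 1) * (((w⁻¹ : (ZMod q)ˣ) : ZMod q) * y) = y := by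
    have h1 : (u : ZMod q) ^ 2 - 1 = 3 := by rw [hu]; norm_num
    have h2' : (3 : ZMod q) * ((w⁻¹ : (ZMod q)ˣ) : ZMod q) = 1 := by
      rw [← hw, ← Units.val_mul, mul_inv_cancel, Units.val_one]
    rw [h1, ← mul_assoc, h2', one_mul]
  rw [← hkey, ← commutatorElement_cfDiag_inv_cfLower]
  exact Subgroup.commutator_mem_commutator (Subgroup.mem_top ((cfDiag u)⁻¹)) (Subgroup.mem_top (cfLower _))

/-- **`SL₂(ℤ/qℤ)` is perfect for `(q, 6) = 1`** (`q ≥ 1`). [folklore] -/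
theorem sl2_commutator_eq_top {q : ℕ} [NeZero q] (hq : Nat.Coprime q 6) : commutator SL(2, ZMod q) = ⊤ := by
  set H := commutator SL(2, ZMod q) with hH
  have hT : cfUpper (1 : ZMod q) ∈ H := cfUpper_mem_commutator hq 1
  have hL : cfLower (1 : ZMod q) ∈ H := cfLower_mem_commutator hq 1
  -- the reductions of `T` and `S = T⁻¹ L T⁻¹` lie in `H`
  have hTred : cfRed q ModularGroup.T = cfUpper (1 : ZMod q) := by
    apply Subtype.ext
    show (Int.castRingHom (ZMod q)).mapMatrix ((ModularGroup.T : SL(2, ℤ)) : Matrix (Fin 2) (Fin 2) ℤ) =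
      !![1, (1 : ZMod q); 0, 1]
    rw [ModularGroup.coe_T]
    ext i j
    fin_cases i <;> fin_cases j <;> simp
  have hSred : cfRed q ModularGroup.S =
      (cfUpper (1 : ZMod q))⁻¹ * cfLower 1 * (cfUpper (1 : ZMod q))⁻¹ := by
    apply Subtype.ext
    rw [Matrix.SpecialLinearGroup.coe_mul, Matrix.SpecialLinearGroup.coe_mul,
      Matrix.SpecialLinearGroup.coe_inv]
    show (Int.castRingHom (ZMod q)).mapMatrix ((ModularGroup.S : SL(2, ℤ)) : Matrix (Fin 2) (Fin 2) ℤ) =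
      Matrix.adjugate !![1, (1 : ZMod q); 0, 1] * !![1, 0; (1 : ZMod q), 1] *
        Matrix.adjugate !![1, (1 : ZMod q); 0, 1]
    rw [ModularGroup.coe_S]
    ext i j
    fin_cases i <;> fin_cases j <;>
      simp [Matrix.adjugate_fin_two, Matrix.mul_apply, Fin.sum_univ_two]
  have hS : cfRed q ModularGroup.S ∈ H := by
    rw [hSred]
    exact H.mul_mem (H.mul_mem (H.inv_mem hT) hL) (H.inv_mem hT)
  have hT' : cfRed q ModularGroup.T ∈ H := by rw [hTred]; exact hT
  have hclos : (⊤ : Subgroup SL(2, ℤ)) ≤ H.comap (cfRed q) := by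
    rw [← SpecialLinearGroup.SL2Z_generators, Subgroup.closure_le]
    rintro γ (rfl | rfl)
    · exact hS
    · exact hT'
  rw [eq_top_iff]
  intro ξ _
  obtain ⟨γ, rfl⟩ :=
    Literature.NumberTheory.EllipticCurves.ModularForms.specialLinearGroup_map_surjective q ξ
  exact hclos (Subgroup.mem_top γ)

/-- **Every homomorphism from `SL₂(ℤ/qℤ)` (`(q,6) = 1`) to a commutative group is trivial.** [folklore] -/
theorem monoidHom_eq_one_of_comm {q : ℕ} [NeZero q] (hq : Nat.Coprime q 6) {M : Type*} [CommGroup M]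
    (f : SL(2, ZMod q) →* M) : f = 1 := by
  have hker : commutator SL(2, ZMod q) ≤ f.ker := by
    rw [commutator_def, Subgroup.commutator_le]
    intro g₁ _ g₂ _
    rw [MonoidHom.mem_ker, map_commutatorElement, commutatorElement_eq_one_iff_commute]
    exact Commute.all _ _
  rw [sl2_commutator_eq_top hq, top_le_iff] at hker
  ext ξ
  have : ξ ∈ f.ker := by rw [hker]; exact Subgroup.mem_top ξ
  rwa [MonoidHom.mem_ker] at this

/-! ### Aperiodicity of generating sets in a perfect finite group -/

/-- **Generating sets of perfect groups are aperiodic:** let `S ⊆ G` be nonempty and generate `G`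
as a group, and let every homomorphism `G →* ℂˣ` be trivial. If `f : G → ℂ` is nowhere zero and
`f(ξ s) = μ f(ξ)` for all `ξ ∈ G`, `s ∈ S`, then `μ = 1`: the scalar `c_g` with `f(ξ g) = c_g f(ξ)`
exists for all `g` in the subgroup generated by `S`, is unique, multiplicative — a character — and
`c_s = μ`. [folklore] -/
theorem eq_one_of_graded_function {G : Type*} [Group G] {S : Set G} (hSne : S.Nonempty)
    (hS : Subgroup.closure S = ⊤) (hperf : ∀ χ : G →* ℂˣ, χ = 1) {f : G → ℂ} (hf : ∀ ξ, f ξ ≠ 0) {μ : ℂ}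
    (hrel : ∀ ξ, ∀ s ∈ S, f (ξ * s) = μ * f ξ) : μ = 1 := by
  obtain ⟨s₀, hs₀⟩ := hSne
  have hμ0 : μ ≠ 0 := by
    intro h0
    have h := hrel 1 s₀ hs₀
    rw [h0, zero_mul, one_mul] at h
    exact hf s₀ h
  -- the `g` admitting a scalar `c_g` with `f(ξ g) = c_g f(ξ)` form a subgroup containing `S`
  let K : Subgroup G :=
    { carrier := {g | ∃ c : ℂ, c ≠ 0 ∧ ∀ ξ, f (ξ * g) = c * f ξ}
      mul_mem' := by
        rintro g h ⟨c, hc, hg⟩ ⟨d, hd, hh⟩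
        refine ⟨c * d, mul_ne_zero hc hd, fun ξ => ?_⟩
        rw [← mul_assoc, hh, hg]; ring
      one_mem' := ⟨1, one_ne_zero, fun ξ => by rw [mul_one, one_mul]⟩
      inv_mem' := by
        rintro g ⟨c, hc, hg⟩
        refine ⟨c⁻¹, inv_ne_zero hc, fun ξ => ?_⟩
        have h := hg (ξ * g⁻¹)
        rw [inv_mul_cancel_right] at h
        rw [h]; field_simp }
  have hK : K = ⊤ := by
    rw [eq_top_iff, ← hS, Subgroup.closure_le]
    exact fun s hs => ⟨μ, hμ0, fun ξ => hrel ξ s hs⟩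
  -- existence and uniqueness of the scalar
  have hc : ∀ g : G, ∃! c : ℂ, c ≠ 0 ∧ ∀ ξ, f (ξ * g) = c * f ξ := by
    intro g
    have hg : g ∈ K := by rw [hK]; exact Subgroup.mem_top g
    obtain ⟨c, hc0, hcg⟩ := hg
    refine ⟨c, ⟨hc0, hcg⟩, fun d ⟨_, hdg⟩ => ?_⟩
    have h1 := hcg 1
    have h2 := hdg 1
    rw [h1] at h2
    exact (mul_right_cancel₀ (hf 1) h2).symm
  choose c hcspec hcuniq using hc
  have hcmul : ∀ g h, c (g * h) = c g * c h := by
    intro g h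
    symm
    refine hcuniq (g * h) _ ⟨mul_ne_zero (hcspec g).1 (hcspec h).1, fun ξ => ?_⟩
    rw [← mul_assoc, (hcspec h).2, (hcspec g).2]; ring
  have hc1 : c 1 = 1 := by
    have h := (hcspec 1).2 1
    rw [mul_one] at h
    exact mul_right_cancel₀ (hf 1) (h.symm.trans (one_mul _).symm)
  -- the character `g ↦ c_g`
  let χ : G →* ℂˣ :=
    { toFun := fun g => Units.mk0 (c g) (hcspec g).1
      map_one' := Units.ext hc1
      map_mul' := fun g h => Units.ext (hcmul g h) }
  have hχ : (χ s₀ : ℂ) = 1 := by rw [hperf χ]; rfl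
  have hcs : c s₀ = μ := (hcuniq s₀ μ ⟨hμ0, fun ξ => hrel ξ s₀ hs₀⟩).symm
  rw [← hcs]
  exact hχ

end Literature.NumberTheory.Sieve
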